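import Summits.AtomisticToContinuum.Crystallization.Theses.FluxTubeKepler
import Literature.MathematicalPhysics.StatisticalMechanics.PeriodicConfigurationDelone
import Literature.MathematicalPhysics.StatisticalMechanics.CrystallizationLocalLimit
import Summits.AtomisticToContinuum.Crystallization.Theorems.ChargedEnergyGap.Negative.PeriodicFormConverse

/-!
# `FluxCellKepler` (stmt-AtomisticToContinuum-15221), negative side I
# — Barlow identification is inside the crux

Negative-lane analysis of the rank-2 crux `FluxCellKepler = ∃ P₀ R₁ τ, Dom R₁ τ ∧ Kepler P₀ R₁ τ` of
route `FluxTubeKepler` (a LOCAL tail credit `τ` dominating the `r⁻⁶` site energies, whose cell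
functional obeys a Hales-type inequality with the sharp constant `e(P₀)` and a linear penalty on
sites that are not two-way matched with a relaxed Barlow / layered set).  Certified here, from tree
facts only (`crysEnergyLimit`, `eStar_le`, the block machinery of `ChargedEnergyGap/Negative`):

* `floor`, `witness_energy_eq_eStar`, `witness_isLeast` — any witness satisfies
  `N · e(P₀) ≤ E_LJ(x)` on every finite injective `x`, hence `e(P₀) = e⋆` and `P₀` is a periodic
  minimiser (attainment, item 0627, and conjunct (i) are inside the crux);
* `witness_goodRel` — KEPLER run on large blocks of `P₀` itself (trial states) with DOM bounding its
  right-hand side by `E(block) − N e(P₀) = o(N)`: EVERY site of `P₀` is `(R, η)`-layered-good for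
  all `R, η > 0`.  So a witness is a periodic Lennard-Jones minimiser that is locally a relaxed
  Barlow stacking (`a ∈ [47/50,1]`, Hägg word, spacings in `[39a/50, 17a/20]`) at every scale: the
  periodic crystal-STRUCTURE problem is inside the crux, not only attainment;
* kill criterion `not_fluxCellKepler_of_minimisers_not_layered` (contrapositive, for disprovers).

No statement of the route is asserted; nothing here closes an item (`--supports` the crux).
All `[folklore]`.
-/

noncomputable section

namespace Summit.AtomisticToContinuum.Crystallization.Theorems.FluxCellKepler.Negative

open scoped BigOperators
open Literature.MathematicalPhysics.StatisticalMechanics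
open Summit.AtomisticToContinuum.Crystallization.Theses.FluxTubeKepler

/-- Euclidean 3-space. [folklore] -/
abbrev E3 : Type := EuclideanSpace ℝ (Fin 3)

/-! ## The crux split into its conjuncts -/

/-- The crux's defect predicate, verbatim: site `i` is `(R, η)`-layered-GOOD. [folklore] -/
def Good (R η : ℝ) {N : ℕ} (x : Fin N → E3) (i : Fin N) : Prop :=
  ∃ a : ℝ, 47 / 50 ≤ a ∧ a ≤ 1 ∧ ∃ (A : EuclideanSpace ℝ (Fin 3) →ₗᵢ[ℝ] EuclideanSpace ℝ (Fin 3))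
    (s : ℤ → ℤ) (z : ℤ → ℝ), Literature.MathematicalPhysics.StatisticalMechanics.IsHaggSeq s ∧
    (∀ m : ℤ, 39 / 50 * a ≤ z (m + 1) - z m ∧ z (m + 1) - z m ≤ 17 / 20 * a) ∧
    let S : Set (EuclideanSpace ℝ (Fin 3)) := {p | ∃ m k l : ℤ, p = A (((k : ℝ) •
      Literature.MathematicalPhysics.StatisticalMechanics.triangularVec₁ a) + ((l : ℝ) •
      Literature.MathematicalPhysics.StatisticalMechanics.triangularVec₂ a) +
      ((Literature.MathematicalPhysics.StatisticalMechanics.haggLabel s m : ℝ) •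
      Literature.MathematicalPhysics.StatisticalMechanics.barlowOffset a) + (z m •
      Literature.MathematicalPhysics.StatisticalMechanics.layerNormal 1))};
    (∀ p ∈ S, ‖p‖ ≤ R → ∃ j : Fin N, dist (x j - x i) p ≤ η) ∧
      (∀ j : Fin N, ‖x j - x i‖ ≤ R → ∃ p ∈ S, dist (x j - x i) p ≤ η)

/-- (DOM): the local tail credit dominates the true `r⁻⁶` site energies in sum, on EVERY finite
injective configuration (no separation assumed). [folklore] -/
def Dom (R₁ : ℝ) (τ : Finset E3 → ℝ) : Prop :=
  ∀ (N : ℕ) (x : Fin N → EuclideanSpace ℝ (Fin 3)), Function.Injective x →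
    ∑ i, Literature.MathematicalPhysics.StatisticalMechanics.siteEnergy (fun r => (r⁻¹) ^ 6) x i ≤
      ∑ i, τ ((Finset.univ.filter fun j : Fin N => dist (x j) (x i) ≤ R₁).image fun j => x j - x i)

/-- (KEPLER): the flux-cell Kepler inequality with the sharp constant `e(P₀)` and a linear defect
penalty, verbatim. [folklore] -/
def Kepler (P₀ : PeriodicConfiguration 3) (R₁ : ℝ) (τ : Finset E3 → ℝ) : Prop :=
  ∀ δ : ℝ, 0 < δ → ∀ R η : ℝ, 0 < R → 0 < η → ∃ c : ℝ, 0 < c ∧ ∀ (N : ℕ)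
    (x : Fin N → EuclideanSpace ℝ (Fin 3)), Function.Injective x →
    (∀ i j, i ≠ j → δ ≤ dist (x i) (x j)) →
    c * (Nat.card {i : Fin N // ¬ ∃ a : ℝ, 47 / 50 ≤ a ∧ a ≤ 1 ∧
      ∃ (A : EuclideanSpace ℝ (Fin 3) →ₗᵢ[ℝ] EuclideanSpace ℝ (Fin 3)) (s : ℤ → ℤ) (z : ℤ → ℝ),
      Literature.MathematicalPhysics.StatisticalMechanics.IsHaggSeq s ∧
      (∀ m : ℤ, 39 / 50 * a ≤ z (m + 1) - z m ∧ z (m + 1) - z m ≤ 17 / 20 * a) ∧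
      let S : Set (EuclideanSpace ℝ (Fin 3)) := {p | ∃ m k l : ℤ, p = A (((k : ℝ) •
        Literature.MathematicalPhysics.StatisticalMechanics.triangularVec₁ a) + ((l : ℝ) •
        Literature.MathematicalPhysics.StatisticalMechanics.triangularVec₂ a) +
        ((Literature.MathematicalPhysics.StatisticalMechanics.haggLabel s m : ℝ) •
        Literature.MathematicalPhysics.StatisticalMechanics.barlowOffset a) + (z m •
        Literature.MathematicalPhysics.StatisticalMechanics.layerNormal 1))};
      (∀ p ∈ S, ‖p‖ ≤ R → ∃ j : Fin N, dist (x j - x i) p ≤ η) ∧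
        (∀ j : Fin N, ‖x j - x i‖ ≤ R → ∃ p ∈ S, dist (x j - x i) p ≤ η)} : ℝ) ≤
    ∑ i, ((1 / 24 : ℝ) * Literature.MathematicalPhysics.StatisticalMechanics.siteEnergy
      (fun r => (r⁻¹) ^ 12) x i - (1 / 12 : ℝ) *
      τ ((Finset.univ.filter fun j : Fin N => dist (x j) (x i) ≤ R₁).image fun j => x j - x i)) -
      (N : ℝ) *
        P₀.energyPerParticle Literature.MathematicalPhysics.StatisticalMechanics.lennardJones

/-- The crux is, by definition, `∃ P₀ R₁ τ, Dom R₁ τ ∧ Kepler P₀ R₁ τ`. [folklore] -/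
theorem fluxCellKepler_iff :
    FluxCellKepler ↔ ∃ (P₀ : PeriodicConfiguration 3) (R₁ : ℝ) (τ : Finset E3 → ℝ),
      Dom R₁ τ ∧ Kepler P₀ R₁ τ :=
  Iff.rfl

/-! ## The floor and the minimiser (X ⊇ conjunct (i) + attainment) -/

/-- Every finite injective configuration is `δ`-separated for some `δ > 0`. [folklore] -/
theorem exists_sep {N : ℕ} {x : Fin N → E3} (hx : Function.Injective x) :
    ∃ δ : ℝ, 0 < δ ∧ ∀ i j : Fin N, i ≠ j → δ ≤ dist (x i) (x j) := by
  classical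
  set D : Finset ℝ := ((Finset.univ : Finset (Fin N × Fin N)).filter fun p => p.1 ≠ p.2).image
    fun p => dist (x p.1) (x p.2) with hD_def
  have hmem : ∀ i j : Fin N, i ≠ j → dist (x i) (x j) ∈ D := fun i j hij =>
    Finset.mem_image.2 ⟨(i, j), Finset.mem_filter.2 ⟨Finset.mem_univ _, hij⟩, rfl⟩
  by_cases hD : D.Nonempty
  · refine ⟨D.min' hD, ?_, fun i j hij => D.min'_le _ (hmem i j hij)⟩
    refine (Finset.lt_min'_iff _ _).2 fun y hy => ?_
    obtain ⟨p, hp, rfl⟩ := Finset.mem_image.1 hy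
    exact dist_pos.2 (hx.ne (Finset.mem_filter.1 hp).2)
  · exact ⟨1, one_pos, fun i j hij => absurd ⟨_, hmem i j hij⟩ hD⟩

/-- **KEPLER ⇒ its right-hand side is non-negative on EVERY finite injective configuration**
(instantiate `δ` = the configuration's own minimal distance). [folklore] -/
theorem Kepler.rhs_nonneg {P₀ : PeriodicConfiguration 3} {R₁ : ℝ} {τ : Finset E3 → ℝ}
    (h : Kepler P₀ R₁ τ) {N : ℕ} {x : Fin N → E3} (hx : Function.Injective x) :
    0 ≤ ∑ i, ((1 / 24 : ℝ) * siteEnergy (fun r => (r⁻¹) ^ 12) x i - (1 / 12 : ℝ) *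
      τ ((Finset.univ.filter fun j : Fin N => dist (x j) (x i) ≤ R₁).image fun j => x j - x i)) -
      (N : ℝ) * P₀.energyPerParticle lennardJones := by
  obtain ⟨δ, hδ, hsep⟩ := exists_sep hx
  obtain ⟨c, hc, hK⟩ := h δ hδ 1 1 one_pos one_pos
  exact le_trans (mul_nonneg hc.le (Nat.cast_nonneg _)) (hK N x hx hsep)

/-- The Lennard-Jones site energy splits into the two inverse powers. [folklore] -/
theorem siteEnergy_lennardJones {N : ℕ} (x : Fin N → E3) (i : Fin N) :
    siteEnergy lennardJones x i = (1 / 12 : ℝ) * siteEnergy (fun r => (r⁻¹) ^ 12) x i -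
      (1 / 6 : ℝ) * siteEnergy (fun r => (r⁻¹) ^ 6) x i := by
  unfold siteEnergy lennardJones
  rw [Finset.sum_sub_distrib, Finset.mul_sum, Finset.mul_sum]

/-- **The energy identity behind the crux's constants**:
`E_LJ = Σ_i ((1/24) site₁₂ − (1/12) site₆)`.
[folklore] -/
theorem interactionEnergy_eq_sum {N : ℕ} (x : Fin N → E3) :
    interactionEnergy lennardJones x = ∑ i, ((1 / 24 : ℝ) * siteEnergy (fun r => (r⁻¹) ^ 12) x i -
      (1 / 12 : ℝ) * siteEnergy (fun r => (r⁻¹) ^ 6) x i) := by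
  have h := two_mul_interactionEnergy lennardJones x
  simp only [siteEnergy_lennardJones] at h
  have : ∑ i, ((1 / 24 : ℝ) * siteEnergy (fun r => (r⁻¹) ^ 12) x i -
      (1 / 12 : ℝ) * siteEnergy (fun r => (r⁻¹) ^ 6) x i) = (1 / 2 : ℝ) *
      ∑ i, ((1 / 12 : ℝ) * siteEnergy (fun r => (r⁻¹) ^ 12) x i -
        (1 / 6 : ℝ) * siteEnergy (fun r => (r⁻¹) ^ 6) x i) := by
    rw [Finset.mul_sum]
    exact Finset.sum_congr rfl fun i _ => by ring
  rw [this]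
  linarith

/-- **DOM + KEPLER ⇒ the sharp floor `N · e(P₀) ≤ E_LJ(x)` on every finite injective `x`.**
[folklore] -/
theorem floor {P₀ : PeriodicConfiguration 3} {R₁ : ℝ} {τ : Finset E3 → ℝ}
    (hD : Dom R₁ τ) (hK : Kepler P₀ R₁ τ) {N : ℕ} {x : Fin N → E3} (hx : Function.Injective x) :
    (N : ℝ) * P₀.energyPerParticle lennardJones ≤ interactionEnergy lennardJones x := by
  have h1 := hK.rhs_nonneg hx
  have h2 := hD N x hx
  rw [interactionEnergy_eq_sum]
  rw [Finset.sum_sub_distrib] at h1 ⊢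
  rw [← Finset.mul_sum, ← Finset.mul_sum] at h1 ⊢
  linarith

open Summit.AtomisticToContinuum.Crystallization.Theorems.ChargedEnergyGapNegative in
/-- **Any witness `P₀` is a periodic minimiser: `e(P₀) = e⋆ = ⨅_Q e(Q)`** (floor on the
Lennard-Jones ground states + the tree's `crysEnergyLimit` and `eStar_le`).  So X contains item
0627 (attainment) and conjunct (i) of the summit. [folklore] -/
theorem witness_energy_eq_eStar {P₀ : PeriodicConfiguration 3} {R₁ : ℝ} {τ : Finset E3 → ℝ}
    (hD : Dom R₁ τ) (hK : Kepler P₀ R₁ τ) : P₀.energyPerParticle lennardJones = eStar := by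
  refine le_antisymm ?_ (eStar_le P₀)
  refine ge_of_tendsto crysEnergyLimit (Filter.eventually_atTop.2 ⟨1, fun N hN => ?_⟩)
  obtain ⟨x, hx⟩ := LennardJonesGroundStatesExist_holds N
  have h1 := floor hD hK hx.1
  rw [hx.2] at h1
  have hNr : (0 : ℝ) < N := by exact_mod_cast hN
  rw [le_div_iff₀ hNr, mul_comm]
  exact h1

open Summit.AtomisticToContinuum.Crystallization.Theorems.ChargedEnergyGapNegative in
/-- Hence any witness `P₀` is a least element of the periodic energies per particle. [folklore] -/
theorem witness_isLeast {P₀ : PeriodicConfiguration 3} {R₁ : ℝ} {τ : Finset E3 → ℝ}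
    (hD : Dom R₁ τ) (hK : Kepler P₀ R₁ τ) :
    IsLeast (Set.range fun Q : PeriodicConfiguration 3 => Q.energyPerParticle lennardJones)
      (P₀.energyPerParticle lennardJones) := by
  refine ⟨⟨P₀, rfl⟩, ?_⟩
  rintro _ ⟨Q, rfl⟩
  rw [witness_energy_eq_eStar hD hK]
  exact eStar_le Q

/-! ## Barlow identification is INSIDE the crux

KEPLER charges `c(δ,R,η) > 0` for every site whose `R`-neighbourhood is not two-way `η`-matched
with a relaxed Barlow / layered set.  Run it on large blocks of the witness `P₀` itself: by DOM
the right-hand side is at most `E(block) − N e(P₀) = o(N)` (blocks are trial states, tree lemma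
`exists_block_energy_le`), so all but `o(N)` block sites are good; deep block sites see exactly
the `P₀`-neighbourhood (tree lemma `exists_eq_toP_of_dist_lt`), and goodness of a site of `P₀`
depends only on its motif class.  Hence EVERY site of `P₀` is `(R, η)`-layered-good, for all
`R, η > 0` (`witness_goodRel`): a witness of X is a periodic Lennard-Jones minimiser
(`witness_isLeast`) that is
locally a relaxed Barlow stacking at every scale — the periodic LJ crystal-STRUCTURE problem
(which polytype / that it is close-packed at all), not only attainment, is inside the crux.
Kill criterion: `not_fluxCellKepler_of_minimisers_not_layered`. -/

/-- The layered (relaxed Barlow) reference set with parameters `a, A, s, z` (verbatim body).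
[folklore] -/
def layeredSet (a : ℝ) (A : E3 →ₗᵢ[ℝ] E3) (s : ℤ → ℤ) (z : ℤ → ℝ) : Set E3 :=
  {p | ∃ m k l : ℤ, p = A (((k : ℝ) • triangularVec₁ a) + ((l : ℝ) • triangularVec₂ a) +
    ((haggLabel s m : ℝ) • barlowOffset a) + (z m • layerNormal 1))}

/-- Two-way `η`-matching on the `R`-ball of a set `V` of relative positions with a reference
set `S`. [folklore] -/
def Matches (R η : ℝ) (V S : Set E3) : Prop :=
  (∀ p ∈ S, ‖p‖ ≤ R → ∃ v ∈ V, dist v p ≤ η) ∧ (∀ v ∈ V, ‖v‖ ≤ R → ∃ p ∈ S, dist v p ≤ η)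

/-- `(R, η)`-layered-goodness of an arbitrary set `V` of relative positions (the crux's defect
predicate, with the finite configuration replaced by `V`). [folklore] -/
def GoodRel (R η : ℝ) (V : Set E3) : Prop :=
  ∃ a : ℝ, 47 / 50 ≤ a ∧ a ≤ 1 ∧ ∃ (A : E3 →ₗᵢ[ℝ] E3) (s : ℤ → ℤ) (z : ℤ → ℝ), IsHaggSeq s ∧
    (∀ m : ℤ, 39 / 50 * a ≤ z (m + 1) - z m ∧ z (m + 1) - z m ≤ 17 / 20 * a) ∧
    Matches R η V (layeredSet a A s z)

/-- The crux's predicate is `GoodRel` of the finite set of relative positions. [folklore] -/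
theorem good_iff_goodRel (R η : ℝ) {N : ℕ} (x : Fin N → E3) (i : Fin N) :
    Good R η x i ↔ GoodRel R η (Set.range fun j => x j - x i) := by
  unfold Good GoodRel Matches layeredSet
  simp only [Set.forall_mem_range, Set.exists_range_iff]

/-- Goodness passes to a larger set of relative positions that agrees on the `R`-ball. [folklore] -/
theorem GoodRel.mono {R η : ℝ} {V₁ V₂ : Set E3} (h : GoodRel R η V₁) (h12 : V₁ ⊆ V₂)
    (h21 : ∀ v ∈ V₂, ‖v‖ ≤ R → v ∈ V₁) : GoodRel R η V₂ := by
  obtain ⟨a, ha1, ha2, A, s, z, hs, hz, h1, h2⟩ := h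
  refine ⟨a, ha1, ha2, A, s, z, hs, hz, ?_, ?_⟩
  · intro p hp hpR
    obtain ⟨v, hv, hd⟩ := h1 p hp hpR
    exact ⟨v, h12 hv, hd⟩
  · intro v hv hvR
    exact h2 v (h21 v hv hvR) hvR

/-- The set of relative positions of a periodic configuration seen from `y`. [folklore] -/
def relSet (P : PeriodicConfiguration 3) (y : E3) : Set E3 := {v | y + v ∈ P.points}

/-- Relative positions are the same from lattice-equivalent points. [folklore] -/
theorem relSet_add (P : PeriodicConfiguration 3) {y g : E3} (hg : g ∈ P.lattice) :
    relSet P (y + g) = relSet P y := by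
  ext v
  simp only [relSet, Set.mem_setOf_eq]
  rw [add_right_comm, P.add_mem_points_iff hg]

section Blocks

open Summit.AtomisticToContinuum.Crystallization.Theorems.ChargedEnergyGapNegative
open Summit.AtomisticToContinuum.Crystallization.Theorems.ChargedEnergyGapNegative.Blocks

/-- **Deep block sites see the whole `P`-neighbourhood**: if a `(depth (R+1))`-deep block site
is good in the block, the corresponding site of `P` is good in `P`. [folklore] -/
theorem goodRel_relSet_of_good (P : PeriodicConfiguration 3) (K : ℕ) {R η : ℝ} {u : BIdx P K}
    (hdeep : IsDeep K (depth P (R + 1)) u.2)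
    (hg : Good R η (blockConfig P K) (Fintype.equivFin (BIdx P K) u)) :
    GoodRel R η (relSet P (bpt P K u)) := by
  rw [good_iff_goodRel] at hg
  have hxi : blockConfig P K (Fintype.equivFin (BIdx P K) u) = bpt P K u := by
    rw [blockConfig_apply, Equiv.symm_apply_apply]
  refine hg.mono ?_ ?_
  · rintro _ ⟨j, rfl⟩
    show bpt P K u + (blockConfig P K j - blockConfig P K (Fintype.equivFin _ u)) ∈ P.points
    rw [hxi, add_sub_cancel, blockConfig_apply]
    exact bpt_mem P K _
  · intro v hv hvR
    by_cases hv0 : v = 0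
    · refine ⟨Fintype.equivFin _ u, ?_⟩
      show blockConfig P K (Fintype.equivFin _ u) - blockConfig P K (Fintype.equivFin _ u) = v
      rw [sub_self, hv0]
    · have hq : bpt P K u + v ∈ P.points := hv
      have hne : (⟨bpt P K u + v, hq⟩ : P.points) ≠ toP P K u := by
        intro h
        have h' := congrArg Subtype.val h
        simp only [val_toP] at h'
        exact hv0 (by simpa using h')
      have hlt : dist (bpt P K u) (bpt P K u + v) < R + 1 := by
        rw [dist_comm, dist_eq_norm, add_sub_cancel_left]
        linarith
      obtain ⟨w, -, hw⟩ := exists_eq_toP_of_dist_lt P K hdeep ⟨bpt P K u + v, hq⟩ hne hlt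
      refine ⟨Fintype.equivFin _ w, ?_⟩
      show blockConfig P K (Fintype.equivFin _ w) - blockConfig P K (Fintype.equivFin _ u) = v
      rw [hxi, blockConfig_apply, Equiv.symm_apply_apply]
      have : bpt P K w = bpt P K u + v := congrArg Subtype.val hw
      rw [this, add_sub_cancel_left]

/-- **X ⇒ every site of the witness `P₀` is `(R, η)`-layered-good, for all `R, η > 0`.**
[folklore] -/
theorem witness_goodRel {P₀ : PeriodicConfiguration 3} {R₁ : ℝ} {τ : Finset E3 → ℝ}
    (hD : Dom R₁ τ) (hK : Kepler P₀ R₁ τ) {R η : ℝ} (hR : 0 < R) (hη : 0 < η) :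
    ∀ y ∈ P₀.points, GoodRel R η (relSet P₀ y) := by
  classical
  by_contra hbad
  push Not at hbad
  obtain ⟨y₀, hy₀, hbad⟩ := hbad
  obtain ⟨m₀, hm₀, g₀, hg₀, rfl⟩ := hy₀
  rw [relSet_add P₀ hg₀] at hbad
  -- separation of `P₀`, the KEPLER constant at `(δ₀, R, η)`
  obtain ⟨δ₀, hδ₀, hsep⟩ := P₀.exists_pos_le_dist
  obtain ⟨c, hc, hKc⟩ := hK δ₀ hδ₀ R η hR hη
  have hF : (0 : ℝ) < P₀.motif.card := by exact_mod_cast P₀.motif_nonempty.card_pos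
  -- blocks are trial states with slack `c / (2 #F)` per particle
  obtain ⟨K₀, hK₀, hKE⟩ := exists_block_energy_le P₀ (show 0 < c / (2 * P₀.motif.card) by
    positivity)
  set d : ℕ := depth P₀ (R + 1) with hd
  set K : ℕ := max K₀ (12 * d + 1) with hKdef
  have hKK₀ : K₀ ≤ K := le_max_left _ _
  have hKd : 12 * d + 1 ≤ K := le_max_right _ _
  set x := blockConfig P₀ K with hxdef
  have hinj : Function.Injective x := blockConfig_injective P₀ K
  have hmem : ∀ i, x i ∈ P₀.points := fun i => by
    rw [hxdef, blockConfig_apply]; exact bpt_mem P₀ K _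
  have hsepx : ∀ i j, i ≠ j → δ₀ ≤ dist (x i) (x j) := fun i j hij =>
    hsep _ (hmem i) _ (hmem j) (hinj.ne hij)
  have hkep := hKc _ x hinj hsepx
  change c * (Nat.card {i // ¬ Good R η x i} : ℝ) ≤ _ at hkep
  -- the right-hand side is at most `E(block) − N e(P₀) ≤ N · c/(2#F) = c K³ / 2`
  have hdom := hD _ x hinj
  have hE := hKE K hKK₀
  have hn : ((Fintype.card (BIdx P₀ K) : ℕ) : ℝ) = P₀.motif.card * (K : ℝ) ^ 3 := by
    exact_mod_cast card_BIdx P₀ K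
  rw [← hxdef, hn] at hE
  have hrhs : ∑ i, ((1 / 24 : ℝ) * siteEnergy (fun r => (r⁻¹) ^ 12) x i - (1 / 12 : ℝ) *
      τ ((Finset.univ.filter fun j => dist (x j) (x i) ≤ R₁).image fun j => x j - x i)) ≤
      interactionEnergy lennardJones x := by
    rw [interactionEnergy_eq_sum]
    simp only [Finset.sum_sub_distrib, ← Finset.mul_sum]
    linarith
  have hslack : (P₀.motif.card : ℝ) * (K : ℝ) ^ 3 * (P₀.energyPerParticle lennardJones +
      c / (2 * P₀.motif.card)) = (P₀.motif.card : ℝ) * (K : ℝ) ^ 3 *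
      P₀.energyPerParticle lennardJones + c * (K : ℝ) ^ 3 / 2 := by
    field_simp
  have hN : ((Fintype.card (BIdx P₀ K) : ℕ) : ℝ) = P₀.motif.card * (K : ℝ) ^ 3 := hn
  have hbadle : c * (Nat.card {i // ¬ Good R η x i} : ℝ) ≤ c * (K : ℝ) ^ 3 / 2 := by
    rw [hN] at hkep
    linarith
  -- deep block sites over `m₀` are bad in the block
  let f : {k : Fin 3 → Fin K // IsDeep K d k} → {i // ¬ Good R η x i} := fun k =>
    ⟨Fintype.equivFin (BIdx P₀ K) (⟨m₀, hm₀⟩, k.1), fun hg => hbad (by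
      have := goodRel_relSet_of_good P₀ K (u := (⟨m₀, hm₀⟩, k.1)) k.2 hg
      rwa [bpt, relSet_add P₀ (latVec_mem P₀ _)] at this)⟩
  have hf : Function.Injective f := by
    rintro ⟨k, hk⟩ ⟨k', hk'⟩ h
    have h' := congrArg (fun w => (Fintype.equivFin (BIdx P₀ K)).symm w.1) h
    simp only [f, Equiv.symm_apply_apply, Prod.mk.injEq, true_and] at h'
    exact Subtype.ext h'
  have hcard := Nat.card_le_card_of_injective f hf
  have hdeep := card_deep_ge K d
  -- numerics: `c (K³ − 6 d K²) ≤ c K³ / 2` forces `K ≤ 12 d`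
  have h1 : ((K : ℝ) ^ 3 - 6 * d * (K : ℝ) ^ 2) ≤ (Nat.card {i // ¬ Good R η x i} : ℝ) := by
    have := (Nat.cast_le (α := ℝ)).2 (hdeep.trans (Nat.add_le_add_right hcard _))
    push_cast at this ⊢
    linarith
  have h2 : c * ((K : ℝ) ^ 3 - 6 * d * (K : ℝ) ^ 2) ≤ c * (K : ℝ) ^ 3 / 2 :=
    (mul_le_mul_of_nonneg_left h1 hc.le).trans hbadle
  have hK1 : (12 * d + 1 : ℝ) ≤ K := by exact_mod_cast hKd
  have hKpos : (0 : ℝ) < K := by linarith [show (0:ℝ) ≤ d from Nat.cast_nonneg d]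
  have h3 : c * (K : ℝ) ^ 2 * ((K : ℝ) / 2 - 6 * d) ≤ 0 := by nlinarith
  have h4 : 0 < c * (K : ℝ) ^ 2 := by positivity
  have h5 : (K : ℝ) / 2 - 6 * d ≤ 0 := by
    by_contra h6
    push Not at h6
    linarith [mul_pos h4 h6]
  linarith

end Blocks

open Summit.AtomisticToContinuum.Crystallization.Theorems.ChargedEnergyGapNegative in
/-- **X ⇒ a periodic Lennard-Jones minimiser that is locally a relaxed Barlow stacking at every
scale**: some least-energy periodic configuration has ALL its sites `(R, η)`-layered-good for
every `R, η > 0`. [folklore] -/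
theorem fluxCellKepler_imp_layered_minimiser (h : FluxCellKepler) :
    ∃ P₀ : PeriodicConfiguration 3,
      IsLeast (Set.range fun Q : PeriodicConfiguration 3 => Q.energyPerParticle lennardJones)
        (P₀.energyPerParticle lennardJones) ∧
      ∀ R η : ℝ, 0 < R → 0 < η → ∀ y ∈ P₀.points, GoodRel R η (relSet P₀ y) := by
  obtain ⟨P₀, R₁, τ, hD, hK⟩ := fluxCellKepler_iff.1 h
  exact ⟨P₀, witness_isLeast hD hK, fun R η hR hη => witness_goodRel hD hK hR hη⟩

/-- **Kill criterion (structure of minimisers).** If every periodic Lennard-Jones minimiser has,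
at some scale `(R, η)`, a site whose `R`-neighbourhood is not two-way `η`-matched with any relaxed
Barlow / layered set of the box (`a ∈ [47/50, 1]`, Hägg word, spacings in `[39a/50, 17a/20]`) —
in particular if there is NO periodic minimiser, or if the minimiser is not close-packed — then
`FluxCellKepler` is false. [folklore] -/
theorem not_fluxCellKepler_of_minimisers_not_layered
    (h : ∀ P : PeriodicConfiguration 3,
      IsLeast (Set.range fun Q : PeriodicConfiguration 3 => Q.energyPerParticle lennardJones)
        (P.energyPerParticle lennardJones) →
      ∃ R η : ℝ, 0 < R ∧ 0 < η ∧ ∃ y ∈ P.points, ¬ GoodRel R η (relSet P y)) :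
    ¬ FluxCellKepler := by
  intro hX
  obtain ⟨P₀, hP₀, hgood⟩ := fluxCellKepler_imp_layered_minimiser hX
  obtain ⟨R, η, hR, hη, y, hy, hbad⟩ := h P₀ hP₀
  exact hbad (hgood R η hR hη y hy)

end Summit.AtomisticToContinuum.Crystallization.Theorems.FluxCellKepler.Negative

end
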